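import Mathlib.Analysis.Complex.Exponential
import Mathlib.Analysis.SpecialFunctions.Exp
import Mathlib.Tactic.NoncommRing
import Mathlib.Tactic.Positivity
import Mathlib.Tactic.FieldSimp
import Mathlib.Tactic.GCongr
import Mathlib.Tactic.Linarith
import Mathlib.Tactic.Ring

/-!
# B13ReadingsLineProducts — row NE5, located junction J-avg-reg (GAPS § G-ne5p1-Javg-reg), file 1 of 2: ORDERED PRODUCTS IN A NORMED RING and
# the CORRECTED STRAIGHT-LINE PRODUCT `C·Π_{t<n} f_t` read as a scale-`ℓ` connection coefficient — three product estimates without `‖1‖ = 1`,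
# and the line-mean ∕ size ∕ two-line bounds with explicit constants (consumed by `B13ReadingsAvgTowerDirect`, file 2)

Cell `pub-balaban`, unit `b2b-balaban-t4-ne5-p1` (row NE5 OWNER, gen 39; owner item «g39-a», `HOME/CLAIMS.log` NOTE + INTENT l.22995, GAPS
§ G-ne5p1-Javg-reg (gen 39)).  Summits-side NEW WORK under the LEAN PLACEMENT RULE: [folklore] normed-ring ∕ normed-algebra estimates (Mathlib
only); two data `def`s (`lprod`, `lineMean`), no `Prop`-valued fact minted, nothing printed asserted, no citation tag.  HONEST FRAMING: rung (B)+1 of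
the FINITE-VOLUME T⁴ programme — NOT infinite volume, NOT a mass gap, NOT the Clay problem, NOT a proof of NE5 (NOT PRINTED; GAPS G-t4-U3-1), NOT a
proof of NE2, NOT a statement about Bałaban's block average.  HONEST DEPENDENCY (cell, verbatim): continuum YM on T⁴ ⇐ BetaPertH ∧ nine spine
estimates (0/9 proved); BetaPertH ⇐ (D1) ∧ (D4) ∧ CAP+tail; G-an2-4 gates asym, D1 and NE2/3/4.

WHY (see file 2 for the chain).  Row NE2's bridge `NE2FromNE3BavgBridge.localRate_regClass_of_bavg_consistent` produces the W1-chain binder `hloc`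
from four tower letters; for Bałaban's AVERAGING towers the first-order ones reduce to «coarse transporter = correction × straight product of fine
transporters» plus a correction bound.  The mechanism is elementary and lives here, GENERIC in the number `n` of factors (one step: `n = L`; the
direct representation of a (K+1−k)-fold average: `n = L^{K+1−k}` finest factors — the road to k-UNIFORM letters, since the one-step Lipschitz bound
compounds under iteration):
* §1 `lprod f n = f 0 * ⋯ * f (n−1)` and `‖Π f_t − 1‖ ≤ Π(1 + ‖f_t − 1‖) − 1` (`norm_lprod_sub_one_le`), the SECOND-ORDER estimate
  `‖Π f_t − 1 − Σ(f_t − 1)‖ ≤ Π(1 + ‖f_t − 1‖) − 1 − Σ‖f_t − 1‖` (`norm_lprod_sub_one_sub_sum_le`), the telescoping estimate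
  `‖Π f_t − Π g_t‖ ≤ (1 + e)^n·Σ‖f_t − g_t‖` (`norm_lprod_sub_lprod_le`); `Π(1 + e_t) ≤ exp Σ e_t`; `e^s − 1 − s ≤ s²` on `[0, 1]`;
* §2 with factors of scaled size `‖(nℓ)•(f_t − 1)‖ ≤ α ≤ ℓ` and `‖C − 1‖ ≤ κc`: `‖ℓ•(C·Π f_t − 1) − lineMean‖ ≤ ℓ·κc·e^{α∕ℓ} + α²∕ℓ`
  (`norm_scaled_corrLine_sub_lineMean_le`), `‖ℓ•(C·Π f_t − 1)‖ ≤ α + (ℓ·κc·e^{α∕ℓ} + α²∕ℓ)` (`norm_scaled_corrLine_le`), and for two lines with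
  `‖f_t − g_t‖ ≤ δ`, `‖C′ − C‖ ≤ κΔ`: `‖ℓ•(C′·Π g_t − C·Π f_t)‖ ≤ ℓ·e^{α∕ℓ}(κΔ + (1 + κc)·n·δ)` (`norm_scaled_corrLine_sub_corrLine_le`).
0 sorry; axioms ⊆ {propext, Classical.choice, Quot.sound}.
-/

noncomputable section

open scoped BigOperators

namespace Summit.QuantumFields.BalabanUV.T4Continuum.B13ReadingsLineProducts

/-! ## §1 Ordered products in a normed ring: three elementary estimates -/

section Products

variable {A : Type*} [NormedRing A]

/-- [folklore] the ORDERED product `f 0 * f 1 * ⋯ * f (n−1)` (empty product `1`). -/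
def lprod (f : ℕ → A) : ℕ → A
  | 0 => 1
  | n + 1 => lprod f n * f n

/-- [folklore] `lprod f 0 = 1`. -/
@[simp] theorem lprod_zero (f : ℕ → A) : lprod f 0 = 1 := rfl

/-- [folklore] `lprod f (n+1) = lprod f n * f n`. -/
theorem lprod_succ (f : ℕ → A) (n : ℕ) : lprod f (n + 1) = lprod f n * f n := rfl

/-- [folklore] the product depends only on the first `n` factors. -/
theorem lprod_congr {f g : ℕ → A} {n : ℕ} (h : ∀ t < n, f t = g t) : lprod f n = lprod g n := by
  induction n with
  | zero => rfl
  | succ n ih =>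
    rw [lprod_succ, lprod_succ, ih (fun t ht => h t (Nat.lt_succ_of_lt ht)), h n (Nat.lt_succ_self n)]

/-- [folklore] **FIRST PRODUCT ESTIMATE**: `‖Π f_t − 1‖ ≤ Π (1 + ‖f_t − 1‖) − 1` (no `‖1‖` needed). -/
theorem norm_lprod_sub_one_le (f : ℕ → A) (n : ℕ) :
    ‖lprod f n - 1‖ ≤ (∏ t ∈ Finset.range n, (1 + ‖f t - 1‖)) - 1 := by
  induction n with
  | zero => simp
  | succ n ih =>
    rw [lprod_succ, Finset.prod_range_succ]
    have key : lprod f n * f n - 1 = (lprod f n - 1) * (f n - 1) + (lprod f n - 1) + (f n - 1) := by noncomm_ring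
    rw [key]
    calc ‖(lprod f n - 1) * (f n - 1) + (lprod f n - 1) + (f n - 1)‖
        ≤ ‖lprod f n - 1‖ * ‖f n - 1‖ + ‖lprod f n - 1‖ + ‖f n - 1‖ :=
          (norm_add_le _ _).trans (add_le_add ((norm_add_le _ _).trans (add_le_add (norm_mul_le _ _) le_rfl)) le_rfl)
      _ ≤ ((∏ t ∈ Finset.range n, (1 + ‖f t - 1‖)) - 1) * ‖f n - 1‖
            + ((∏ t ∈ Finset.range n, (1 + ‖f t - 1‖)) - 1) + ‖f n - 1‖ := by
          gcongr
      _ = (∏ t ∈ Finset.range n, (1 + ‖f t - 1‖)) * (1 + ‖f n - 1‖) - 1 := by ring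

/-- [folklore] **SECOND PRODUCT ESTIMATE** (second order): `‖Π f_t − 1 − Σ (f_t − 1)‖ ≤ Π (1 + ‖f_t − 1‖) − 1 − Σ ‖f_t − 1‖`. -/
theorem norm_lprod_sub_one_sub_sum_le (f : ℕ → A) (n : ℕ) :
    ‖lprod f n - 1 - ∑ t ∈ Finset.range n, (f t - 1)‖
      ≤ (∏ t ∈ Finset.range n, (1 + ‖f t - 1‖)) - 1 - ∑ t ∈ Finset.range n, ‖f t - 1‖ := by
  induction n with
  | zero => simp
  | succ n ih =>
    rw [lprod_succ, Finset.prod_range_succ, Finset.sum_range_succ, Finset.sum_range_succ]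
    have key : lprod f n * f n - 1 - (∑ t ∈ Finset.range n, (f t - 1) + (f n - 1))
        = (lprod f n - 1 - ∑ t ∈ Finset.range n, (f t - 1)) + (lprod f n - 1) * (f n - 1) := by noncomm_ring
    rw [key]
    calc ‖(lprod f n - 1 - ∑ t ∈ Finset.range n, (f t - 1)) + (lprod f n - 1) * (f n - 1)‖
        ≤ ‖lprod f n - 1 - ∑ t ∈ Finset.range n, (f t - 1)‖ + ‖lprod f n - 1‖ * ‖f n - 1‖ :=
          (norm_add_le _ _).trans (add_le_add le_rfl (norm_mul_le _ _))
      _ ≤ ((∏ t ∈ Finset.range n, (1 + ‖f t - 1‖)) - 1 - ∑ t ∈ Finset.range n, ‖f t - 1‖)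
            + ((∏ t ∈ Finset.range n, (1 + ‖f t - 1‖)) - 1) * ‖f n - 1‖ :=
          add_le_add ih (mul_le_mul_of_nonneg_right (norm_lprod_sub_one_le f n) (norm_nonneg _))
      _ = (∏ t ∈ Finset.range n, (1 + ‖f t - 1‖)) * (1 + ‖f n - 1‖) - 1
            - (∑ t ∈ Finset.range n, ‖f t - 1‖ + ‖f n - 1‖) := by ring

/-- [folklore] **THIRD PRODUCT ESTIMATE** (telescoping): if every factor of both products is within `e` of `1`, then
`‖Π f_t − Π g_t‖ ≤ (1 + e)^n · Σ ‖f_t − g_t‖`. -/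
theorem norm_lprod_sub_lprod_le {f g : ℕ → A} {e : ℝ} {n : ℕ} (hf : ∀ t < n, ‖f t - 1‖ ≤ e) (hg : ∀ t < n, ‖g t - 1‖ ≤ e) :
    ‖lprod f n - lprod g n‖ ≤ (1 + e) ^ n * ∑ t ∈ Finset.range n, ‖f t - g t‖ := by
  induction n with
  | zero => simp
  | succ n ih =>
    have hf' : ∀ t < n, ‖f t - 1‖ ≤ e := fun t ht => hf t (Nat.lt_succ_of_lt ht)
    have hg' : ∀ t < n, ‖g t - 1‖ ≤ e := fun t ht => hg t (Nat.lt_succ_of_lt ht)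
    have he : 0 ≤ e := (norm_nonneg _).trans (hf n (Nat.lt_succ_self n))
    have h1e : 1 ≤ 1 + e := le_add_of_nonneg_right he
    have hPg : ‖lprod g n - 1‖ ≤ (1 + e) ^ n - 1 := by
      refine (norm_lprod_sub_one_le g n).trans (sub_le_sub_right ?_ _)
      calc ∏ t ∈ Finset.range n, (1 + ‖g t - 1‖) ≤ ∏ _t ∈ Finset.range n, (1 + e) :=
            Finset.prod_le_prod (fun t _ => by positivity) (fun t ht => add_le_add le_rfl (hg' t (Finset.mem_range.1 ht)))
        _ = (1 + e) ^ n := by rw [Finset.prod_const, Finset.card_range]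
    have hD := ih hf' hg'
    rw [lprod_succ, lprod_succ, Finset.sum_range_succ]
    have key : lprod f n * f n - lprod g n * g n
        = (lprod f n - lprod g n) * (f n - 1) + (lprod f n - lprod g n) + (lprod g n - 1) * (f n - g n) + (f n - g n) := by
      noncomm_ring
    rw [key]
    have hS : 0 ≤ ∑ t ∈ Finset.range n, ‖f t - g t‖ := Finset.sum_nonneg fun _ _ => norm_nonneg _
    calc ‖(lprod f n - lprod g n) * (f n - 1) + (lprod f n - lprod g n) + (lprod g n - 1) * (f n - g n) + (f n - g n)‖
        ≤ ‖lprod f n - lprod g n‖ * ‖f n - 1‖ + ‖lprod f n - lprod g n‖ + ‖lprod g n - 1‖ * ‖f n - g n‖ + ‖f n - g n‖ := by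
          refine (norm_add_le _ _).trans (add_le_add ((norm_add_le _ _).trans (add_le_add ((norm_add_le _ _).trans
            (add_le_add (norm_mul_le _ _) le_rfl)) (norm_mul_le _ _))) le_rfl)
      _ ≤ ((1 + e) ^ n * ∑ t ∈ Finset.range n, ‖f t - g t‖) * e + (1 + e) ^ n * ∑ t ∈ Finset.range n, ‖f t - g t‖
            + ((1 + e) ^ n - 1) * ‖f n - g n‖ + ‖f n - g n‖ := by
          gcongr
          · exact hf n (Nat.lt_succ_self n)
      _ = (1 + e) ^ n * ((1 + e) * ∑ t ∈ Finset.range n, ‖f t - g t‖ + ‖f n - g n‖) := by ring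
      _ ≤ (1 + e) ^ n * ((1 + e) * ∑ t ∈ Finset.range n, ‖f t - g t‖ + (1 + e) * ‖f n - g n‖) := by
          gcongr
          exact le_mul_of_one_le_left (norm_nonneg _) h1e
      _ = (1 + e) ^ (n + 1) * (∑ t ∈ Finset.range n, ‖f t - g t‖ + ‖f n - g n‖) := by ring

/-- [folklore] `Π_{t<n} (1 + e_t) ≤ exp (Σ_{t<n} e_t)`. -/
theorem prod_one_add_le_exp_sum (e : ℕ → ℝ) (he : ∀ t, 0 ≤ e t) (n : ℕ) :
    ∏ t ∈ Finset.range n, (1 + e t) ≤ Real.exp (∑ t ∈ Finset.range n, e t) := by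
  rw [Real.exp_sum]
  exact Finset.prod_le_prod (fun t _ => by have := he t; positivity) fun t _ => by
    rw [add_comm]; exact Real.add_one_le_exp (e t)

/-- [folklore] for `0 ≤ s ≤ 1`: `exp s − 1 − s ≤ s²`. -/
theorem exp_sub_one_sub_le_sq {s : ℝ} (hs0 : 0 ≤ s) (hs1 : s ≤ 1) : Real.exp s - 1 - s ≤ s ^ 2 :=
  (le_abs_self _).trans (Real.abs_exp_sub_one_sub_id_le (by rwa [abs_of_nonneg hs0]))

end Products

/-! ## §2 A CORRECTED LINE PRODUCT `C · Π_{t<n} f_t` read as a connection coefficient at scale `ℓ`, the factors read at scale `ℓ′ = n·ℓ` -/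

section CorrectedLine

variable {A : Type*} [NormedRing A] [NormedAlgebra ℂ A]

/-- [folklore] the LINE MEAN `n⁻¹ Σ_{t<n} ℓ′•(f_t − 1)` of the fine connection coefficients of the `n` factors. -/
def lineMean (ℓ' n : ℕ) (f : ℕ → A) : A := ((n : ℂ))⁻¹ • ∑ t ∈ Finset.range n, ((ℓ' : ℂ) • (f t - 1))

/-- [folklore] scaled size letter ⟹ plain distance of each factor from `1`. -/
theorem norm_sub_one_le_of_scaled {ℓ' : ℕ} (hℓ' : 0 < ℓ') {x : A} {α : ℝ} (h : ‖((ℓ' : ℕ) : ℂ) • (x - 1)‖ ≤ α) :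
    ‖x - 1‖ ≤ α / ℓ' := by
  have hℓ'r : (0 : ℝ) < ℓ' := by exact_mod_cast hℓ'
  rw [norm_smul, Complex.norm_natCast] at h
  rwa [le_div_iff₀ hℓ'r, mul_comm]

/-- [folklore] `lineMean (n·ℓ) n f = ℓ • Σ_{t<n} (f_t − 1)`. -/
theorem lineMean_eq_smul_sum {ℓ n : ℕ} (hn : 0 < n) (f : ℕ → A) :
    lineMean (n * ℓ) n f = ((ℓ : ℕ) : ℂ) • ∑ t ∈ Finset.range n, (f t - 1) := by
  have hn' : (n : ℂ) ≠ 0 := by exact_mod_cast hn.ne'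
  rw [lineMean, ← Finset.smul_sum, smul_smul, Nat.cast_mul, ← mul_assoc, inv_mul_cancel₀ hn', one_mul]

/-- [folklore] `‖lineMean‖ ≤ α` when every scaled factor is within `α`. -/
theorem norm_lineMean_le {ℓ' n : ℕ} (hn : 0 < n) {f : ℕ → A} {α : ℝ} (hα : ∀ t < n, ‖((ℓ' : ℕ) : ℂ) • (f t - 1)‖ ≤ α) :
    ‖lineMean ℓ' n f‖ ≤ α := by
  have hnr : (0 : ℝ) < n := by exact_mod_cast hn
  rw [lineMean, norm_smul, norm_inv, Complex.norm_natCast]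
  calc (n : ℝ)⁻¹ * ‖∑ t ∈ Finset.range n, ((ℓ' : ℕ) : ℂ) • (f t - 1)‖
      ≤ (n : ℝ)⁻¹ * ∑ t ∈ Finset.range n, ‖((ℓ' : ℕ) : ℂ) • (f t - 1)‖ :=
        mul_le_mul_of_nonneg_left (norm_sum_le _ _) (by positivity)
    _ ≤ (n : ℝ)⁻¹ * ∑ _t ∈ Finset.range n, α :=
        mul_le_mul_of_nonneg_left (Finset.sum_le_sum fun t ht => hα t (Finset.mem_range.1 ht)) (by positivity)
    _ = α := by rw [Finset.sum_const, Finset.card_range, nsmul_eq_mul, ← mul_assoc, inv_mul_cancel₀ hnr.ne', one_mul]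

/-- [folklore] the sum of the plain distances is at most `α∕ℓ` (`n` factors, each `≤ α∕(nℓ)`). -/
theorem sum_norm_sub_one_le {ℓ n : ℕ} (hℓ : 0 < ℓ) (hn : 0 < n) {f : ℕ → A} {α : ℝ}
    (hα : ∀ t < n, ‖((n * ℓ : ℕ) : ℂ) • (f t - 1)‖ ≤ α) : ∑ t ∈ Finset.range n, ‖f t - 1‖ ≤ α / ℓ := by
  have hnr : (0 : ℝ) < n := by exact_mod_cast hn
  have hℓr : (0 : ℝ) < ℓ := by exact_mod_cast hℓ
  have he : ∀ t < n, ‖f t - 1‖ ≤ α / ((n * ℓ : ℕ) : ℝ) := fun t ht => norm_sub_one_le_of_scaled (Nat.mul_pos hn hℓ) (hα t ht)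
  calc ∑ t ∈ Finset.range n, ‖f t - 1‖ ≤ ∑ _t ∈ Finset.range n, α / ((n * ℓ : ℕ) : ℝ) :=
        Finset.sum_le_sum fun t ht => he t (Finset.mem_range.1 ht)
    _ = α / ℓ := by rw [Finset.sum_const, Finset.card_range, nsmul_eq_mul, Nat.cast_mul]; field_simp

/-- [folklore] **THE CORRECTED LINE PRODUCT IS THE LINE MEAN UP TO `(ℓ·κc·e^{α∕ℓ} + α²∕ℓ)`.**  For `n ≥ 1` factors `f_t` with
scaled size `‖(nℓ)•(f_t − 1)‖ ≤ α ≤ ℓ` and a correction factor `‖C − 1‖ ≤ κc`: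
`‖ℓ•(C·Π f_t − 1) − lineMean‖ ≤ ℓ·κc·exp(α∕ℓ) + α²∕ℓ` — the three product estimates of §1 + `e^s − 1 − s ≤ s²`. -/
theorem norm_scaled_corrLine_sub_lineMean_le {ℓ n : ℕ} (hℓ : 0 < ℓ) (hn : 0 < n) {f : ℕ → A} {α κc : ℝ}
    (hα : ∀ t < n, ‖((n * ℓ : ℕ) : ℂ) • (f t - 1)‖ ≤ α) (hαℓ : α ≤ ℓ) {C : A} (hC : ‖C - 1‖ ≤ κc) :
    ‖((ℓ : ℕ) : ℂ) • (C * lprod f n - 1) - lineMean (n * ℓ) n f‖ ≤ ℓ * κc * Real.exp (α / ℓ) + α ^ 2 / ℓ := by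
  have hℓr : (0 : ℝ) < ℓ := by exact_mod_cast hℓ
  have hα0 : 0 ≤ α := (norm_nonneg _).trans (hα 0 hn)
  have hκc : 0 ≤ κc := (norm_nonneg _).trans hC
  set P := lprod f n with hP
  set S := ∑ t ∈ Finset.range n, (f t - 1) with hS
  set s := ∑ t ∈ Finset.range n, ‖f t - 1‖ with hs
  have hs_le : s ≤ α / ℓ := sum_norm_sub_one_le hℓ hn hα
  have hs0 : 0 ≤ s := Finset.sum_nonneg fun _ _ => norm_nonneg _
  have hs1 : s ≤ 1 := hs_le.trans ((div_le_one hℓr).2 hαℓ)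
  have hprod : ∏ t ∈ Finset.range n, (1 + ‖f t - 1‖) ≤ Real.exp s := prod_one_add_le_exp_sum _ (fun _ => norm_nonneg _) n
  have hexp : Real.exp s ≤ Real.exp (α / ℓ) := Real.exp_le_exp.2 hs_le
  have hP1 : ‖P - 1‖ + 1 ≤ Real.exp (α / ℓ) := by
    have := norm_lprod_sub_one_le f n; rw [← hP] at this; linarith
  have hP2 : ‖P - 1 - S‖ ≤ (α / ℓ) ^ 2 := by
    have h2 := norm_lprod_sub_one_sub_sum_le f n
    rw [← hP, ← hS, ← hs] at h2
    calc ‖P - 1 - S‖ ≤ Real.exp s - 1 - s := h2.trans (by linarith)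
      _ ≤ s ^ 2 := exp_sub_one_sub_le_sq hs0 hs1
      _ ≤ (α / ℓ) ^ 2 := pow_le_pow_left₀ hs0 hs_le 2
  have hring : C * P - 1 - S = ((C - 1) * (P - 1) + (C - 1)) + (P - 1 - S) := by noncomm_ring
  rw [lineMean_eq_smul_sum hn, ← hS, ← smul_sub, hring, smul_add]
  have hn1 : ‖((ℓ : ℕ) : ℂ) • ((C - 1) * (P - 1) + (C - 1))‖ ≤ ℓ * κc * Real.exp (α / ℓ) := by
    rw [norm_smul, Complex.norm_natCast, mul_assoc]
    refine mul_le_mul_of_nonneg_left ?_ hℓr.le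
    calc ‖(C - 1) * (P - 1) + (C - 1)‖ ≤ ‖C - 1‖ * ‖P - 1‖ + ‖C - 1‖ :=
          (norm_add_le _ _).trans (add_le_add (norm_mul_le _ _) le_rfl)
      _ = ‖C - 1‖ * (‖P - 1‖ + 1) := by ring
      _ ≤ κc * Real.exp (α / ℓ) := mul_le_mul hC hP1 (by positivity) hκc
  have hn2 : ‖((ℓ : ℕ) : ℂ) • (P - 1 - S)‖ ≤ α ^ 2 / ℓ := by
    rw [norm_smul, Complex.norm_natCast]
    calc (ℓ : ℝ) * ‖P - 1 - S‖ ≤ ℓ * (α / ℓ) ^ 2 := mul_le_mul_of_nonneg_left hP2 hℓr.le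
      _ = α ^ 2 / ℓ := by field_simp
  exact (norm_add_le _ _).trans (add_le_add hn1 hn2)

/-- [folklore] **SIZE of the corrected line product as a scale-`ℓ` connection**: `‖ℓ•(C·Π f_t − 1)‖ ≤ α + ℓ·κc·e^{α∕ℓ} + α²∕ℓ`. -/
theorem norm_scaled_corrLine_le {ℓ n : ℕ} (hℓ : 0 < ℓ) (hn : 0 < n) {f : ℕ → A} {α κc : ℝ}
    (hα : ∀ t < n, ‖((n * ℓ : ℕ) : ℂ) • (f t - 1)‖ ≤ α) (hαℓ : α ≤ ℓ) {C : A} (hC : ‖C - 1‖ ≤ κc) :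
    ‖((ℓ : ℕ) : ℂ) • (C * lprod f n - 1)‖ ≤ α + (ℓ * κc * Real.exp (α / ℓ) + α ^ 2 / ℓ) := by
  have h1 := norm_scaled_corrLine_sub_lineMean_le hℓ hn hα hαℓ hC
  have h2 := norm_lineMean_le (ℓ' := n * ℓ) hn hα
  calc ‖((ℓ : ℕ) : ℂ) • (C * lprod f n - 1)‖
      = ‖lineMean (n * ℓ) n f + (((ℓ : ℕ) : ℂ) • (C * lprod f n - 1) - lineMean (n * ℓ) n f)‖ := by rw [add_sub_cancel]
    _ ≤ ‖lineMean (n * ℓ) n f‖ + ‖((ℓ : ℕ) : ℂ) • (C * lprod f n - 1) - lineMean (n * ℓ) n f‖ := norm_add_le _ _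
    _ ≤ α + (ℓ * κc * Real.exp (α / ℓ) + α ^ 2 / ℓ) := add_le_add h2 h1

/-- [folklore] **TWO CORRECTED LINE PRODUCTS WITH PAIRWISE CLOSE FACTORS** (the Lipschitz mechanism): factors of scaled size `≤ α`,
`‖f_t − g_t‖ ≤ δ`, corrections `‖C − 1‖ ≤ κc`, `‖C′ − C‖ ≤ κΔ` ⟹ `‖ℓ•(C′·Π g_t − C·Π f_t)‖ ≤ ℓ·e^{α∕ℓ}·(κΔ + (1 + κc)·n·δ)`. -/
theorem norm_scaled_corrLine_sub_corrLine_le {ℓ n : ℕ} (hℓ : 0 < ℓ) (hn : 0 < n) {f g : ℕ → A} {α κc κΔ δ : ℝ}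
    (hαf : ∀ t < n, ‖((n * ℓ : ℕ) : ℂ) • (f t - 1)‖ ≤ α) (hαg : ∀ t < n, ‖((n * ℓ : ℕ) : ℂ) • (g t - 1)‖ ≤ α)
    (hδ : ∀ t < n, ‖f t - g t‖ ≤ δ) {C C' : A} (hC : ‖C - 1‖ ≤ κc) (hCC : ‖C' - C‖ ≤ κΔ) :
    ‖((ℓ : ℕ) : ℂ) • (C' * lprod g n - C * lprod f n)‖ ≤ ℓ * Real.exp (α / ℓ) * (κΔ + (1 + κc) * n * δ) := by
  have hℓr : (0 : ℝ) < ℓ := by exact_mod_cast hℓ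
  have hnr : (0 : ℝ) < n := by exact_mod_cast hn
  have hnℓ : 0 < n * ℓ := Nat.mul_pos hn hℓ
  have hα0 : 0 ≤ α := (norm_nonneg _).trans (hαf 0 hn)
  have hκc : 0 ≤ κc := (norm_nonneg _).trans hC
  have hκΔ : 0 ≤ κΔ := (norm_nonneg _).trans hCC
  have hδ0 : 0 ≤ δ := (norm_nonneg _).trans (hδ 0 hn)
  set e := α / ((n * ℓ : ℕ) : ℝ) with he_def
  have hef : ∀ t < n, ‖f t - 1‖ ≤ e := fun t ht => norm_sub_one_le_of_scaled hnℓ (hαf t ht)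
  have heg : ∀ t < n, ‖g t - 1‖ ≤ e := fun t ht => norm_sub_one_le_of_scaled hnℓ (hαg t ht)
  have he0 : 0 ≤ e := by positivity
  -- `(1 + e)^n ≤ exp (α / ℓ)`
  have hpow : (1 + e) ^ n ≤ Real.exp (α / ℓ) := by
    calc (1 + e) ^ n ≤ (Real.exp e) ^ n := pow_le_pow_left₀ (by positivity) (by rw [add_comm]; exact Real.add_one_le_exp e) n
      _ = Real.exp (n * e) := by rw [← Real.exp_nat_mul]
      _ = Real.exp (α / ℓ) := by congr 1; rw [he_def, Nat.cast_mul]; field_simp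
  set P := lprod f n
  set P' := lprod g n
  have hPP : ‖P' - P‖ ≤ Real.exp (α / ℓ) * (n * δ) := by
    have h := norm_lprod_sub_lprod_le heg hef
    calc ‖P' - P‖ ≤ (1 + e) ^ n * ∑ t ∈ Finset.range n, ‖g t - f t‖ := h
      _ ≤ Real.exp (α / ℓ) * ∑ _t ∈ Finset.range n, δ := by
          refine mul_le_mul hpow (Finset.sum_le_sum fun t ht => ?_) (Finset.sum_nonneg fun _ _ => norm_nonneg _) (by positivity)
          rw [norm_sub_rev]; exact hδ t (Finset.mem_range.1 ht)
      _ = Real.exp (α / ℓ) * (n * δ) := by rw [Finset.sum_const, Finset.card_range, nsmul_eq_mul]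
  have hP'1 : ‖P' - 1‖ + 1 ≤ Real.exp (α / ℓ) := by
    have h1 := norm_lprod_sub_one_le g n
    have h2 : ∏ t ∈ Finset.range n, (1 + ‖g t - 1‖) ≤ (1 + e) ^ n := by
      calc ∏ t ∈ Finset.range n, (1 + ‖g t - 1‖) ≤ ∏ _t ∈ Finset.range n, (1 + e) :=
            Finset.prod_le_prod (fun t _ => by positivity) (fun t ht => add_le_add le_rfl (heg t (Finset.mem_range.1 ht)))
        _ = (1 + e) ^ n := by rw [Finset.prod_const, Finset.card_range]
    change ‖P' - 1‖ + 1 ≤ _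
    linarith
  have hring : C' * P' - C * P = ((C' - C) * (P' - 1) + (C' - C)) + ((C - 1) * (P' - P) + (P' - P)) := by noncomm_ring
  rw [hring, norm_smul, Complex.norm_natCast, mul_assoc]
  refine mul_le_mul_of_nonneg_left ?_ hℓr.le
  calc ‖((C' - C) * (P' - 1) + (C' - C)) + ((C - 1) * (P' - P) + (P' - P))‖
      ≤ (‖C' - C‖ * ‖P' - 1‖ + ‖C' - C‖) + (‖C - 1‖ * ‖P' - P‖ + ‖P' - P‖) :=
        (norm_add_le _ _).trans (add_le_add ((norm_add_le _ _).trans (add_le_add (norm_mul_le _ _) le_rfl))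
          ((norm_add_le _ _).trans (add_le_add (norm_mul_le _ _) le_rfl)))
    _ = ‖C' - C‖ * (‖P' - 1‖ + 1) + (‖C - 1‖ + 1) * ‖P' - P‖ := by ring
    _ ≤ κΔ * Real.exp (α / ℓ) + (κc + 1) * (Real.exp (α / ℓ) * (n * δ)) := by
        gcongr
    _ = Real.exp (α / ℓ) * (κΔ + (1 + κc) * n * δ) := by ring

end CorrectedLine

end Summit.QuantumFields.BalabanUV.T4Continuum.B13ReadingsLineProducts

end
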